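import Mathlib.Analysis.PSeries
import Mathlib.Algebra.BigOperators.Field
import Mathlib.Analysis.SpecialFunctions.Trigonometric.Bounds
import Mathlib.Analysis.Complex.Trigonometric
import Literature.NumberTheory.LFunctions.GaussianHeckeMeanValue
import Literature.NumberTheory.LFunctions.DoubleLargeSieve
import HarnessLib

/-!
# The improved mean value theorem for Hecke polynomials of `ℤ[i]` — PROVED
# (Järviniemi–Teräväinen 2024, Lemma 3.3)

Topic `Literature/NumberTheory/LFunctions`; companion ("Proofs") file of
`GaussianHeckeMeanValue.lean`, which states the named fact
`JarviniemiTeravainen2024_heckeIMVT` (JT Lemma 3.3, the *improved mean value theorem*):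
there is an absolute `C` such that for `N ≥ 1`, `T ≥ 1` and all coefficients `a`,

`∑_{|m| ≤ T} |∑_{N(n) ≤ N} a_n λ^m(n)|²
    ≤ C T ∑ |a_n|² + C T ∑_{n₁ ≠ n₂, |arg n₁ - arg n₂| ≤ 1/T (mod π/2)} |a_{n₁} a_{n₂}|`.

This file discharges it: `JarviniemiTeravainen2024_heckeIMVT_holds` (with `C = 129`; the
source only asserts `≪`).

## Source

O. Järviniemi, J. Teräväinen, *Gaussian almost primes in almost all narrow sectors*,
Rev. Mat. Iberoam. 40 (2024), no. 4, 1293–1350 = arXiv:2303.05822 [JarviniemiTeravainen2024],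
Lemma 3.3 and its proof (§3.1).

## The printed proof and the proof given here

JT prove Lemma 3.3 with the kernel `g(x) = max(1 - 10T‖x‖, 0)` on `ℝ/ℤ`: its Fourier
coefficients are `≥ 0` and `≫ 1/T` for `|m| ≤ T`, so
`∑_{|m| ≤ T} |F(m)|² ≪ T ∑_{m ∈ ℤ} ĝ(m) |F(m)|²
  = T ∑_{n₁,n₂} a_{n₁} ā_{n₂} g((arg n₁ - arg n₂)/(π/2))`
by Fourier inversion, and `g` vanishes unless `|arg n₁ - arg n₂| ≤ 1/T (mod π/2)`.
Pointwise Fourier inversion on the circle and the exchange of the series over `m ∈ ℤ` with the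
finite sums are comparatively heavy to set up in Mathlib, so we run the SAME positivity argument
with the roles of the two sides of the duality exchanged, which keeps every sum finite:

1. (`mul_sum_Icc_le_sum_prod_range`) *Fejér majorant in `m`*: for `f ≥ 0`,
   `(T+1) ∑_{|m| ≤ T} f(m) ≤ ∑_{0 ≤ j, j' ≤ 2T} f(j - j')` (each `m` is hit `2T+1-|m| ≥ T+1` times).
2. (`sum_norm_sq_expSum_sub_le`) *Expansion*: with `λ^m(n) = e^{i m θ_n}`, `θ_n = 4 arg n`
   (`angularCharZ_eq_exp`),
   `∑_{j,j'} |F(j-j')|² = ∑_{n₁,n₂} a_{n₁} ā_{n₂} |D(θ_{n₁} - θ_{n₂})|² ≤ ∑ |a_{n₁}||a_{n₂}| |D|²`,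
   `D(y) = ∑_{j ≤ 2T} e^{ijy}` (so `|D|²` is `(2T+1)×` the Fejér kernel — nonnegative Fourier
   coefficients for free).
3. (`norm_geom_sum_exp_le`, `norm_geom_sum_mul_norm_sub_one_le`, `two_mul_le_norm_exp_sub_one`)
   *Kernel decay*: `|D(y)| ≤ 2T+1` and `|D(y)| ≤ 2/|e^{iy} - 1| = 1/|sin(y/2)|`, with Jordan's
   inequality `sin x ≥ 2x/π` (`Real.mul_le_sin`).
4. (`norm_geom_sum_sq_le_boxKernel`, `argClose_of_floor_eq`) *Cells*: cut `[0, π/2) ∋ arg n` into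
   `2T` boxes of width `π/(4T) < 1/T`; two points in the same box are `ArgClose`, and for points in
   boxes `i`, `j` one has `|D|² ≤ g(i-j) + g(i-j+2T) + g(i-j-2T)` with the lattice weight
   `g(e) = (2T+1)²` (`|e| ≤ 1`), `4T²/e²` (`|e| ≥ 2`) (the three copies account for closeness
   modulo `π/2`, i.e. `θ` modulo `2π`).
5. (`sum_boxWeight_le`, `sum_mul_kernel_le_boxes`, `schur_sum_mul_le`) *Schur test on boxes*:
   `∑_ℤ g ≤ 3(2T+1)² + 16T² ≤ 43T²` over any set of integers (`∑ 1/j² ≤ 4`), hence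
   `∑_{n₁,n₂} |a_{n₁}||a_{n₂}| |D|² ≤ 129 T² ∑_boxes (∑_{n ∈ box} |a_n|)²`.
6. (`sum_sq_boxSum_le`)
   `∑_boxes (∑_{n ∈ box} |a_n|)² ≤ ∑ |a_n|² + ∑_{n₁ ≠ n₂ close} |a_{n₁} a_{n₂}|`.

Dividing by `T + 1` gives the fact with `C = 129`. Steps 4–5 are the "cell + Schur" device
also used (for integrals instead of sums over `m`) in
`Literature/NumberTheory/LFunctions/DoubleLargeSieve.lean`, whose elementary lattice sum
`DoubleLargeSieve.sum_int_inv_sq_le_four` (`∑_{j ∈ J} 1/j² ≤ 4` over any finite `J ⊂ ℤ`) is reused.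

## Mathlib

`Complex.norm_mul_exp_arg_mul_I`, `Complex.exp_int_mul`, `Complex.exp_nat_mul`,
`Complex.exp_int_mul_two_pi_mul_I`, `Complex.norm_exp_I_mul_ofReal_sub_one`
(`‖e^{ix} - 1‖ = 2|sin(x/2)|`), `Real.mul_le_sin` (Jordan), `geom_sum_mul`,
`Finset.sum_fiberwise_of_maps_to`, `Finset.sum_image`, `Int.floor`. No Fourier series are used.
-/

noncomputable section

open Complex Finset
open scoped Real ComplexConjugate

namespace Literature.NumberTheory.LFunctions.GaussianInt

/-! ### Hecke characters as exponentials -/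

/-- `λ^m(z) = e^{i m (4 arg z)}` for `z ≠ 0` and integer `m` (the integer-index version of
`angularChar_eq_exp`). [cite: JarviniemiTeravainen2024, §1.3] -/
theorem angularCharZ_eq_exp {m : ℤ} {z : GaussianInt} (hz : z ≠ 0) :
    angularCharZ m z = Complex.exp ((m : ℂ) * ((4 * arg (z : ℂ) : ℝ) : ℂ) * I) := by
  have hz' : (z : ℂ) ≠ 0 := by rwa [Ne, GaussianInt.toComplex_eq_zero]
  have hn : (‖(z : ℂ)‖ : ℂ) ≠ 0 := by exact_mod_cast (norm_ne_zero_iff.mpr hz')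
  have hu : (z : ℂ) / (‖(z : ℂ)‖ : ℂ) = Complex.exp (arg (z : ℂ) * I) := by
    rw [div_eq_iff hn, mul_comm]
    exact (Complex.norm_mul_exp_arg_mul_I _).symm
  rw [angularCharZ, hu, ← Complex.exp_int_mul]
  congr 1
  push_cast
  ring

/-! ### Step 1: the Fejér majorant in `m` (counting form) -/

/-- For `f ≥ 0`: `(T+1) ∑_{|m| ≤ T} f(m) ≤ ∑_{0 ≤ j, j' ≤ 2T} f(j - j')`, because each
`m ∈ [-T, T]` is `j - j'` for the `T + 1` pairs `(m⁺ + t, m⁻ + t)`, `0 ≤ t ≤ T`. [folklore] -/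
theorem mul_sum_Icc_le_sum_prod_range (T : ℕ) (f : ℤ → ℝ) (hf : ∀ m, 0 ≤ f m) :
    ((T : ℝ) + 1) * ∑ m ∈ Icc (-(T : ℤ)) T, f m ≤
      ∑ p ∈ range (2 * T + 1) ×ˢ range (2 * T + 1), f ((p.1 : ℤ) - p.2) := by
  classical
  calc ((T : ℝ) + 1) * ∑ m ∈ Icc (-(T : ℤ)) T, f m
      = ∑ m ∈ Icc (-(T : ℤ)) T, ∑ _t ∈ range (T + 1), f m := by
        rw [Finset.mul_sum]
        refine Finset.sum_congr rfl fun m _ => ?_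
        rw [Finset.sum_const, Finset.card_range, nsmul_eq_mul]
        push_cast
        ring
    _ = ∑ p ∈ Icc (-(T : ℤ)) T ×ˢ range (T + 1), f p.1 := by rw [Finset.sum_product]
    _ = ∑ q ∈ (Icc (-(T : ℤ)) T ×ˢ range (T + 1)).image
          (fun p : ℤ × ℕ => (p.1.toNat + p.2, (-p.1).toNat + p.2)), f ((q.1 : ℤ) - q.2) := by
        rw [Finset.sum_image]
        · refine Finset.sum_congr rfl fun p _ => ?_
          congr 1
          push_cast
          omega
        · intro p _ p' _ h
          simp only [Prod.mk.injEq] at h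
          obtain ⟨h1, h2⟩ := h
          have : p.1 = p'.1 := by omega
          ext <;> omega
    _ ≤ ∑ q ∈ range (2 * T + 1) ×ˢ range (2 * T + 1), f ((q.1 : ℤ) - q.2) := by
        refine Finset.sum_le_sum_of_subset_of_nonneg ?_ (fun _ _ _ => hf _)
        intro q hq
        simp only [Finset.mem_image, Finset.mem_product, Finset.mem_Icc, Finset.mem_range] at hq ⊢
        obtain ⟨p, ⟨⟨hp1, hp2⟩, hp3⟩, rfl⟩ := hq
        constructor <;> omega

/-! ### Step 2: expansion of `|F(m)|²` and the Fejér-type kernel `|D|²` -/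

/-- `|∑_n a_n e^{imθ_n}|² = ∑_{n₁,n₂} a_{n₁} conj(a_{n₂}) e^{im(θ_{n₁} - θ_{n₂})}` (as a complex
identity, the left side cast from `ℝ`). [folklore] -/
theorem ofReal_norm_sq_expSum_eq {α : Type*} (S : Finset α) (a : α → ℂ) (θ : α → ℝ) (m : ℤ) :
    (((‖∑ n ∈ S, a n * exp ((m : ℂ) * (θ n : ℂ) * I)‖ ^ 2 : ℝ)) : ℂ) =
      ∑ q ∈ S ×ˢ S, a q.1 * conj (a q.2) * exp ((m : ℂ) * ((θ q.1 - θ q.2 : ℝ) : ℂ) * I) := by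
  rw [← Complex.normSq_eq_norm_sq, ← Complex.mul_conj, map_sum, Finset.sum_mul_sum,
    Finset.sum_product]
  refine Finset.sum_congr rfl fun n₁ _ => Finset.sum_congr rfl fun n₂ _ => ?_
  dsimp only
  rw [map_mul, ← Complex.exp_conj]
  simp only [map_mul, Complex.conj_ofReal, Complex.conj_I, map_intCast]
  rw [mul_mul_mul_comm, ← Complex.exp_add]
  congr 1
  push_cast
  ring

/-- `∑_{0 ≤ j,j' < L} e^{i(j-j')φ} = D · conj D` with `D = ∑_{j<L} (e^{iφ})^j`: the square of the
Dirichlet-type sum is the Fejér-type double sum. [folklore] -/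
theorem sum_prod_exp_sub_eq_mul_conj (φ : ℝ) (L : ℕ) :
    ∑ p ∈ range L ×ˢ range L, exp ((((p.1 : ℤ) - (p.2 : ℤ) : ℤ) : ℂ) * (φ : ℂ) * I) =
      (∑ j ∈ range L, exp ((φ : ℂ) * I) ^ j) * conj (∑ j ∈ range L, exp ((φ : ℂ) * I) ^ j) := by
  rw [map_sum, Finset.sum_mul_sum, Finset.sum_product]
  refine Finset.sum_congr rfl fun j _ => Finset.sum_congr rfl fun j' _ => ?_
  dsimp only
  rw [map_pow, ← Complex.exp_conj, ← Complex.exp_nat_mul, ← Complex.exp_nat_mul, ← Complex.exp_add]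
  congr 1
  simp only [map_mul, Complex.conj_ofReal, Complex.conj_I]
  push_cast
  ring

/-- **Fejér majorant, expanded.** For `F(m) = ∑_n a_n e^{imθ_n}`:
`∑_{0 ≤ j,j' < L} |F(j - j')|² ≤ ∑_{n₁,n₂} |a_{n₁}| |a_{n₂}| |∑_{k<L} e^{ik(θ_{n₁}-θ_{n₂})}|²`
(in fact equality holds with `a_{n₁} conj(a_{n₂})` in place of `|a_{n₁}||a_{n₂}|`). [folklore] -/
theorem sum_norm_sq_expSum_sub_le {α : Type*} (S : Finset α) (a : α → ℂ) (θ : α → ℝ) (L : ℕ)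
    (F : ℤ → ℂ) (hF : ∀ m, F m = ∑ n ∈ S, a n * exp ((m : ℂ) * (θ n : ℂ) * I)) :
    ∑ p ∈ range L ×ˢ range L, ‖F ((p.1 : ℤ) - p.2)‖ ^ 2 ≤
      ∑ q ∈ S ×ˢ S, ‖a q.1‖ * ‖a q.2‖ *
        ‖∑ j ∈ range L, exp (((θ q.1 - θ q.2 : ℝ) : ℂ) * I) ^ j‖ ^ 2 := by
  have key : ((∑ p ∈ range L ×ˢ range L, ‖F ((p.1 : ℤ) - p.2)‖ ^ 2 : ℝ) : ℂ) =
      ∑ q ∈ S ×ˢ S, a q.1 * conj (a q.2) *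
        ((‖∑ j ∈ range L, exp (((θ q.1 - θ q.2 : ℝ) : ℂ) * I) ^ j‖ ^ 2 : ℝ) : ℂ) := by
    calc ((∑ p ∈ range L ×ˢ range L, ‖F ((p.1 : ℤ) - p.2)‖ ^ 2 : ℝ) : ℂ)
        = ∑ p ∈ range L ×ˢ range L, ∑ q ∈ S ×ˢ S, a q.1 * conj (a q.2) *
            exp (((((p.1 : ℤ) - (p.2 : ℤ) : ℤ)) : ℂ) * ((θ q.1 - θ q.2 : ℝ) : ℂ) * I) := by
          rw [Complex.ofReal_sum]
          refine Finset.sum_congr rfl fun p _ => ?_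
          rw [hF, ofReal_norm_sq_expSum_eq]
      _ = ∑ q ∈ S ×ˢ S, ∑ p ∈ range L ×ˢ range L, a q.1 * conj (a q.2) *
            exp (((((p.1 : ℤ) - (p.2 : ℤ) : ℤ)) : ℂ) * ((θ q.1 - θ q.2 : ℝ) : ℂ) * I) :=
          Finset.sum_comm
      _ = _ := by
          refine Finset.sum_congr rfl fun q _ => ?_
          rw [← Finset.mul_sum, sum_prod_exp_sub_eq_mul_conj, ← Complex.normSq_eq_norm_sq,
            ← Complex.mul_conj]
  have key' : ∑ p ∈ range L ×ˢ range L, ‖F ((p.1 : ℤ) - p.2)‖ ^ 2 =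
      (∑ q ∈ S ×ˢ S, a q.1 * conj (a q.2) *
        ((‖∑ j ∈ range L, exp (((θ q.1 - θ q.2 : ℝ) : ℂ) * I) ^ j‖ ^ 2 : ℝ) : ℂ)).re := by
    rw [← key, Complex.ofReal_re]
  rw [key', Complex.re_sum]
  refine Finset.sum_le_sum fun q _ => ?_
  refine (Complex.re_le_norm _).trans ?_
  rw [norm_mul, norm_mul, Complex.norm_conj, Complex.norm_real, Real.norm_of_nonneg (by positivity)]

/-! ### Step 3: size and decay of the kernel `D(y) = ∑_{j<L} e^{ijy}` -/

/-- Trivial bound `|∑_{j<L} e^{ijφ}| ≤ L`. [folklore] -/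
theorem norm_geom_sum_exp_le (φ : ℝ) (L : ℕ) : ‖∑ j ∈ range L, exp ((φ : ℂ) * I) ^ j‖ ≤ L := by
  calc ‖∑ j ∈ range L, exp ((φ : ℂ) * I) ^ j‖ ≤ ∑ j ∈ range L, ‖exp ((φ : ℂ) * I) ^ j‖ :=
        norm_sum_le _ _
    _ = L := by simp [Complex.norm_exp_ofReal_mul_I]

/-- Geometric-sum bound `|∑_{j<L} e^{ijφ}| · |e^{iφ} - 1| ≤ 2` (from `(∑ w^j)(w-1) = w^L - 1`).
[folklore] -/
theorem norm_geom_sum_mul_norm_sub_one_le (φ : ℝ) (L : ℕ) :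
    ‖∑ j ∈ range L, exp ((φ : ℂ) * I) ^ j‖ * ‖exp ((φ : ℂ) * I) - 1‖ ≤ 2 := by
  rw [← norm_mul, geom_sum_mul]
  calc ‖exp ((φ : ℂ) * I) ^ L - 1‖ ≤ ‖exp ((φ : ℂ) * I) ^ L‖ + ‖(1 : ℂ)‖ := norm_sub_le _ _
    _ = 2 := by rw [norm_pow, Complex.norm_exp_ofReal_mul_I]; norm_num

/-- `|e^{iy} - 1| = 2|sin(y/2)|` (Mathlib's `Complex.norm_exp_I_mul_ofReal_sub_one`, reshaped).
[folklore] -/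
theorem norm_exp_ofReal_mul_I_sub_one_eq (y : ℝ) :
    ‖exp ((y : ℂ) * I) - 1‖ = 2 * |Real.sin (y / 2)| := by
  rw [mul_comm, Complex.norm_exp_I_mul_ofReal_sub_one, Real.norm_eq_abs, abs_mul, abs_two]

/-- **Separation gives decay.** If `(e-1)π < T y < (e+1)π` for an integer `e` with
`2 ≤ |e| ≤ T`, then `|e^{iy} - 1| ≥ 2(|e|-1)/T`: indeed `|e^{iy}-1| = 2 sin(|y|/2)` with
`|y|/2 ∈ ((|e|-1)π/(2T), (|e|+1)π/(2T)) ⊆ (0, π)`, and Jordan's inequality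
`sin x ≥ (2/π) min(x, π-x)` (`Real.mul_le_sin`). [folklore] -/
theorem two_mul_le_norm_exp_sub_one {T : ℕ} (hT : 1 ≤ T) {y : ℝ} {e : ℤ}
    (h1 : ((e : ℝ) - 1) * π < T * y) (h2 : (T : ℝ) * y < ((e : ℝ) + 1) * π)
    (he : 2 ≤ |e|) (heT : |e| ≤ (T : ℤ)) :
    2 * (|(e : ℝ)| - 1) ≤ T * ‖exp ((y : ℂ) * I) - 1‖ := by
  have hT' : (1 : ℝ) ≤ T := by exact_mod_cast hT
  have he' : (2 : ℝ) ≤ |(e : ℝ)| := by rw [← Int.cast_abs]; exact_mod_cast he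
  have heT' : |(e : ℝ)| ≤ T := by rw [← Int.cast_abs]; exact_mod_cast heT
  -- bounds for `s = |y| / 2`
  set s : ℝ := |y| / 2 with hs
  have hsin : |Real.sin (y / 2)| = |Real.sin s| := by
    rcases abs_choice y with h | h
    · rw [hs, h]
    · rw [hs, h, neg_div, Real.sin_neg, abs_neg]
  -- `(|e| - 1) π < 2 T s < (|e| + 1) π`
  have hlu : (|(e : ℝ)| - 1) * π < 2 * T * s ∧ 2 * T * s < (|(e : ℝ)| + 1) * π := by
    rcases le_or_gt 0 (e : ℝ) with he0 | he0
    · have he2 : (2 : ℝ) ≤ e := by rwa [abs_of_nonneg he0] at he'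
      have hy : 0 < y := by
        have : 0 < (T : ℝ) * y := lt_of_le_of_lt (by nlinarith [Real.pi_pos]) h1
        exact pos_of_mul_pos_right this (by positivity)
      rw [abs_of_nonneg he0, hs, abs_of_pos hy]
      constructor <;> linarith
    · have he2 : (e : ℝ) ≤ -2 := by rw [abs_of_neg he0] at he'; linarith
      have hy : y < 0 := by
        have : (T : ℝ) * y < 0 := lt_of_lt_of_le h2 (by nlinarith [Real.pi_pos])
        exact neg_of_mul_neg_right this (by positivity)
      rw [abs_of_neg he0, hs, abs_of_neg hy]
      constructor <;> linarith
  obtain ⟨hl, hu⟩ := hlu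
  have hs0 : 0 ≤ s := by positivity
  have hsπ : s ≤ π := by nlinarith [Real.pi_pos]
  -- `sin s ≥ (|e| - 1)/T`
  have hmain : |(e : ℝ)| - 1 ≤ T * Real.sin s := by
    rcases le_or_gt s (π / 2) with hsm | hsm
    · have hj := Real.mul_le_sin hs0 hsm
      have : (|(e : ℝ)| - 1) ≤ T * (2 / π * s) := by
        rw [show (T : ℝ) * (2 / π * s) = 2 * T * s / π by ring, le_div_iff₀ Real.pi_pos]
        exact hl.le
      exact this.trans (mul_le_mul_of_nonneg_left hj (by positivity))
    · have hj := Real.mul_le_sin (x := π - s) (by linarith) (by linarith)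
      rw [Real.sin_pi_sub] at hj
      have : (|(e : ℝ)| - 1) ≤ T * (2 / π * (π - s)) := by
        rw [show (T : ℝ) * (2 / π * (π - s)) = (2 * T * π - 2 * T * s) / π by ring,
          le_div_iff₀ Real.pi_pos]
        nlinarith [Real.pi_pos]
      exact this.trans (mul_le_mul_of_nonneg_left hj (by positivity))
  rw [norm_exp_ofReal_mul_I_sub_one_eq, hsin]
  have : Real.sin s ≤ |Real.sin s| := le_abs_self _
  nlinarith

/-! ### Step 4: angular boxes and the lattice weight `g` -/

/-- **Angular boxes.** For `n ∈ ℤ[i]*` (`0 ≤ arg n < π/2`) and `T ≥ 1`, the box index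
`i = ⌊arg n · 4T/π⌋` satisfies `0 ≤ i ≤ 2T - 1` and `iπ ≤ T · (4 arg n) < (i+1)π`. [folklore] -/
theorem floor_arg_box_bounds {T : ℕ} (hT : 1 ≤ T) {n : GaussianInt} (hn : n ∈ firstQuadrant) :
    0 ≤ ⌊arg (n : ℂ) * (4 * T) / π⌋ ∧ ⌊arg (n : ℂ) * (4 * T) / π⌋ + 1 ≤ 2 * (T : ℤ) ∧
    (⌊arg (n : ℂ) * (4 * T) / π⌋ : ℝ) * π ≤ T * (4 * arg (n : ℂ)) ∧
    (T : ℝ) * (4 * arg (n : ℂ)) < ((⌊arg (n : ℂ) * (4 * T) / π⌋ : ℝ) + 1) * π := by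
  obtain ⟨_, h0, hlt⟩ := mem_firstQuadrant_iff_arg.1 hn
  have hπ := Real.pi_pos
  have hT' : (1 : ℝ) ≤ T := by exact_mod_cast hT
  set x : ℝ := arg (n : ℂ) * (4 * T) / π with hx
  have hxπ : x * π = T * (4 * arg (n : ℂ)) := by
    rw [hx, div_mul_cancel₀ _ hπ.ne']
    ring
  have hx0 : 0 ≤ x := by positivity
  have hxT : x < ((2 * (T : ℤ) : ℤ) : ℝ) := by
    push_cast
    rw [hx, div_lt_iff₀ hπ]
    nlinarith
  refine ⟨Int.floor_nonneg.2 hx0, Int.lt_iff_add_one_le.1 (Int.floor_lt.2 hxT), ?_, ?_⟩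
  · rw [← hxπ]
    exact mul_le_mul_of_nonneg_right (Int.floor_le x) hπ.le
  · rw [← hxπ]
    exact mul_lt_mul_of_pos_right (Int.lt_floor_add_one x) hπ

/-- Two points of `ℤ[i]*` in the same angular box of width `π/(4T)` (`< 1/T`) are `ArgClose T`
(with `k = 0` in the definition of `ArgClose`). [folklore] -/
theorem argClose_of_floor_eq {T : ℕ} (hT : 1 ≤ T) {n₁ n₂ : GaussianInt}
    (h₁ : n₁ ∈ firstQuadrant) (h₂ : n₂ ∈ firstQuadrant)
    (h : ⌊arg (n₁ : ℂ) * (4 * T) / π⌋ = ⌊arg (n₂ : ℂ) * (4 * T) / π⌋) :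
    ArgClose T n₁ n₂ := by
  obtain ⟨-, -, hil, hiu⟩ := floor_arg_box_bounds hT h₁
  obtain ⟨-, -, hjl, hju⟩ := floor_arg_box_bounds hT h₂
  rw [h] at hil hiu
  refine ⟨0, ?_⟩
  simp only [Int.cast_zero, zero_mul, sub_zero]
  have hT' : (0 : ℝ) < T := by exact_mod_cast hT
  rw [le_div_iff₀ hT', ← abs_of_pos hT', ← abs_mul]
  refine le_of_lt (abs_lt.2 ⟨?_, ?_⟩) <;> nlinarith [Real.pi_le_four]

/-- The kernel at separation `e` (in units of `π/T`) is at most the lattice weight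
`g(e) = (2T+1)²` for `|e| ≤ 1`, `4T²/e²` for `2 ≤ |e| ≤ T`:
`|∑_{j ≤ 2T} e^{ijy}|² ≤ g(e)` whenever `(e-1)π < Ty < (e+1)π`. [folklore] -/
theorem norm_geom_sum_sq_le_boxWeight {T : ℕ} (hT : 1 ≤ T) {y : ℝ} {e : ℤ}
    (h1 : ((e : ℝ) - 1) * π < T * y) (h2 : (T : ℝ) * y < ((e : ℝ) + 1) * π) (heT : |e| ≤ (T : ℤ)) :
    ‖∑ j ∈ range (2 * T + 1), exp ((y : ℂ) * I) ^ j‖ ^ 2 ≤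
      if |e| ≤ 1 then (2 * (T : ℝ) + 1) ^ 2 else 4 * (T : ℝ) ^ 2 / (e : ℝ) ^ 2 := by
  split_ifs with he
  · have h := norm_geom_sum_exp_le y (2 * T + 1)
    push_cast at h
    exact pow_le_pow_left₀ (norm_nonneg _) h 2
  · rw [not_le] at he
    have he2 : 2 ≤ |e| := he
    have hE := two_mul_le_norm_exp_sub_one hT h1 h2 he2 heT
    have hD := norm_geom_sum_mul_norm_sub_one_le y (2 * T + 1)
    set D := ‖∑ j ∈ range (2 * T + 1), exp ((y : ℂ) * I) ^ j‖ with hDdef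
    set W := ‖exp ((y : ℂ) * I) - 1‖ with hWdef
    have hD0 : 0 ≤ D := norm_nonneg _
    have he' : (2 : ℝ) ≤ |(e : ℝ)| := by rw [← Int.cast_abs]; exact_mod_cast he2
    have h3 : D * (|(e : ℝ)| - 1) ≤ T := by
      have : D * (2 * (|(e : ℝ)| - 1)) ≤ D * (T * W) := mul_le_mul_of_nonneg_left hE hD0
      nlinarith
    have he0 : (e : ℝ) ≠ 0 := by
      intro h; rw [h, abs_zero] at he'; linarith
    rw [le_div_iff₀ (by positivity)]
    have hsq : (e : ℝ) ^ 2 = |(e : ℝ)| ^ 2 := (sq_abs _).symm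
    have h4 : (D * (|(e : ℝ)| - 1)) ^ 2 ≤ (T : ℝ) ^ 2 :=
      pow_le_pow_left₀ (by nlinarith) h3 2
    have h5 : |(e : ℝ)| ^ 2 ≤ 4 * (|(e : ℝ)| - 1) ^ 2 := by nlinarith
    rw [hsq]
    nlinarith [mul_le_mul_of_nonneg_left h5 (sq_nonneg D)]

/-- **The kernel is dominated by the box kernel.** For `n₁, n₂ ∈ ℤ[i]*` in angular boxes
`i = β n₁`, `j = β n₂` (`β n = ⌊arg n · 4T/π⌋`):
`|∑_{k ≤ 2T} e^{ik(4 arg n₁ - 4 arg n₂)}|² ≤ g(i-j) + g(i-j+2T) + g(i-j-2T)` — one of the three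
shifts `e` of `i - j` by a multiple of `2T` (a full turn of `θ = 4 arg`) has `|e| ≤ T`, and for it
`norm_geom_sum_sq_le_boxWeight` applies; the other two terms are `≥ 0`. [folklore] -/
theorem norm_geom_sum_sq_le_boxKernel {T : ℕ} (hT : 1 ≤ T) (g : ℤ → ℝ)
    (hg : ∀ e, g e = if |e| ≤ 1 then (2 * (T : ℝ) + 1) ^ 2 else 4 * (T : ℝ) ^ 2 / (e : ℝ) ^ 2)
    (β : GaussianInt → ℤ) (hβ : ∀ n, β n = ⌊arg (n : ℂ) * (4 * T) / π⌋)
    {n₁ n₂ : GaussianInt} (h₁ : n₁ ∈ firstQuadrant) (h₂ : n₂ ∈ firstQuadrant) :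
    ‖∑ k ∈ range (2 * T + 1), exp (((4 * arg (n₁ : ℂ) - 4 * arg (n₂ : ℂ) : ℝ) : ℂ) * I) ^ k‖ ^ 2 ≤
      g (β n₁ - β n₂) + g (β n₁ - β n₂ + 2 * T) + g (β n₁ - β n₂ - 2 * T) := by
  obtain ⟨hi0, hiT, hil, hiu⟩ := floor_arg_box_bounds hT h₁
  obtain ⟨hj0, hjT, hjl, hju⟩ := floor_arg_box_bounds hT h₂
  rw [← hβ] at hi0 hiT hil hiu
  rw [← hβ] at hj0 hjT hjl hju
  have hg0 : ∀ e, 0 ≤ g e := fun e => by rw [hg]; split_ifs <;> positivity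
  set y : ℝ := 4 * arg (n₁ : ℂ) - 4 * arg (n₂ : ℂ) with hy
  have hTy : (T : ℝ) * y = T * (4 * arg (n₁ : ℂ)) - T * (4 * arg (n₂ : ℂ)) := by rw [hy]; ring
  have h2π : ∀ c : ℤ, exp ((y : ℂ) * I) = exp (((y + c * (2 * π) : ℝ) : ℂ) * I) := by
    intro c
    push_cast
    rw [add_mul, Complex.exp_add, show (c : ℂ) * (2 * π) * I = c * (2 * π * I) by ring,
      Complex.exp_int_mul_two_pi_mul_I, mul_one]
  have hi0' : (0 : ℝ) ≤ β n₁ := by exact_mod_cast hi0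
  have hj0' : (0 : ℝ) ≤ β n₂ := by exact_mod_cast hj0
  have hiT' : (β n₁ : ℝ) + 1 ≤ 2 * T := by exact_mod_cast hiT
  have hjT' : (β n₂ : ℝ) + 1 ≤ 2 * T := by exact_mod_cast hjT
  rcases le_or_gt (β n₁ - β n₂) T with hle | hgt
  · rcases le_or_gt (-(T : ℤ)) (β n₁ - β n₂) with hge | hlt
    · -- central case, `e = i - j`
      have h1 : (((β n₁ - β n₂ : ℤ)) - 1 : ℝ) * π < T * y := by push_cast; linarith
      have h2 : (T : ℝ) * y < (((β n₁ - β n₂ : ℤ)) + 1 : ℝ) * π := by push_cast; linarith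
      have heT : |β n₁ - β n₂| ≤ (T : ℤ) := abs_le.2 ⟨hge, hle⟩
      refine (norm_geom_sum_sq_le_boxWeight hT h1 h2 heT).trans ?_
      rw [← hg]
      linarith [hg0 (β n₁ - β n₂ + 2 * T), hg0 (β n₁ - β n₂ - 2 * T)]
    · -- `i - j < -T`: shift by `+2T`, `e = i - j + 2T`
      rw [h2π 1]
      have h1 : (((β n₁ - β n₂ + 2 * T : ℤ)) - 1 : ℝ) * π < T * (y + (1 : ℤ) * (2 * π)) := by
        push_cast; nlinarith
      have h2 : (T : ℝ) * (y + (1 : ℤ) * (2 * π)) < (((β n₁ - β n₂ + 2 * T : ℤ)) + 1 : ℝ) * π := by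
        push_cast; nlinarith
      have heT : |β n₁ - β n₂ + 2 * T| ≤ (T : ℤ) := abs_le.2 ⟨by omega, by omega⟩
      refine (norm_geom_sum_sq_le_boxWeight hT h1 h2 heT).trans ?_
      rw [← hg]
      linarith [hg0 (β n₁ - β n₂), hg0 (β n₁ - β n₂ - 2 * T)]
  · -- `i - j > T`: shift by `-2T`, `e = i - j - 2T`
    rw [h2π (-1)]
    have h1 : (((β n₁ - β n₂ - 2 * T : ℤ)) - 1 : ℝ) * π < T * (y + (-1 : ℤ) * (2 * π)) := by
      push_cast; nlinarith
    have h2 : (T : ℝ) * (y + (-1 : ℤ) * (2 * π)) < (((β n₁ - β n₂ - 2 * T : ℤ)) + 1 : ℝ) * π := by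
      push_cast; nlinarith
    have heT : |β n₁ - β n₂ - 2 * T| ≤ (T : ℤ) := abs_le.2 ⟨by omega, by omega⟩
    refine (norm_geom_sum_sq_le_boxWeight hT h1 h2 heT).trans ?_
    rw [← hg]
    linarith [hg0 (β n₁ - β n₂), hg0 (β n₁ - β n₂ + 2 * T)]

/-! ### Lattice sums of the weight -/

/-- **Lattice sums of the weight.** Over ANY finite set of integers,
`∑ g ≤ 3(2T+1)² + 16T²` (`≤ 3` terms equal to `(2T+1)²`, and `4T² ∑ 1/e² ≤ 16T²` by
`DoubleLargeSieve.sum_int_inv_sq_le_four`). [folklore] -/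
theorem sum_boxWeight_le {T : ℕ} (g : ℤ → ℝ)
    (hg : ∀ e, g e = if |e| ≤ 1 then (2 * (T : ℝ) + 1) ^ 2 else 4 * (T : ℝ) ^ 2 / (e : ℝ) ^ 2)
    (E : Finset ℤ) : ∑ e ∈ E, g e ≤ 3 * (2 * (T : ℝ) + 1) ^ 2 + 16 * (T : ℝ) ^ 2 := by
  classical
  rw [← Finset.sum_filter_add_sum_filter_not E (fun e : ℤ => |e| ≤ 1)]
  have h1 : ∑ e ∈ E with |e| ≤ 1, g e ≤ 3 * (2 * (T : ℝ) + 1) ^ 2 := by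
    have hval : ∀ e ∈ E.filter (fun e : ℤ => |e| ≤ 1), g e = (2 * (T : ℝ) + 1) ^ 2 := by
      intro e he
      rw [Finset.mem_filter] at he
      rw [hg, if_pos he.2]
    rw [Finset.sum_congr rfl hval, Finset.sum_const, nsmul_eq_mul]
    have hsub : E.filter (fun e : ℤ => |e| ≤ 1) ⊆ Finset.Icc (-1 : ℤ) 1 := by
      intro e he
      rw [Finset.mem_filter] at he
      rw [Finset.mem_Icc]
      exact abs_le.1 he.2
    have hcard : ((E.filter (fun e : ℤ => |e| ≤ 1)).card : ℝ) ≤ 3 := by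
      have := Finset.card_le_card hsub
      simp at this
      exact_mod_cast this
    have h0 : (0 : ℝ) ≤ (2 * (T : ℝ) + 1) ^ 2 := by positivity
    nlinarith
  have h2 : ∑ e ∈ E with ¬ (|e| ≤ 1), g e ≤ 16 * (T : ℝ) ^ 2 := by
    have hval : ∀ e ∈ E.filter (fun e : ℤ => ¬ (|e| ≤ 1)),
        g e = 4 * (T : ℝ) ^ 2 * ((e : ℝ) ^ 2)⁻¹ := by
      intro e he
      rw [Finset.mem_filter] at he
      rw [hg, if_neg he.2, div_eq_mul_inv]
    rw [Finset.sum_congr rfl hval, ← Finset.mul_sum]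
    calc 4 * (T : ℝ) ^ 2 * ∑ e ∈ E with ¬ (|e| ≤ 1), ((e : ℝ) ^ 2)⁻¹
        ≤ 4 * (T : ℝ) ^ 2 * 4 :=
          mul_le_mul_of_nonneg_left (DoubleLargeSieve.sum_int_inv_sq_le_four _) (by positivity)
      _ = 16 * (T : ℝ) ^ 2 := by ring
  linarith

/-! ### Step 5: the cell argument and the Schur test -/

/-- **Regrouping by boxes.** If `K(n₁,n₂) ≤ ψ(β n₁, β n₂)` on `S` and `c ≥ 0`, then
`∑_{n₁,n₂ ∈ S} c_{n₁} c_{n₂} K(n₁,n₂) ≤ ∑_{i,j} ψ(i,j) A_i A_j` with the box masses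
`A_i = ∑_{n ∈ S, β n = i} c_n`. [folklore] -/
theorem sum_mul_kernel_le_boxes {α : Type*} (S : Finset α) (c : α → ℝ) (K : α → α → ℝ)
    (β : α → ℤ) (ψ : ℤ → ℤ → ℝ) (hc : ∀ n ∈ S, 0 ≤ c n)
    (hK : ∀ n₁ ∈ S, ∀ n₂ ∈ S, K n₁ n₂ ≤ ψ (β n₁) (β n₂)) :
    ∑ q ∈ S ×ˢ S, c q.1 * c q.2 * K q.1 q.2 ≤
      ∑ i ∈ S.image β, ∑ j ∈ S.image β,
        ψ i j * ((∑ n ∈ S with β n = i, c n) * (∑ n ∈ S with β n = j, c n)) := by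
  classical
  have hmaps : ∀ n ∈ S, β n ∈ S.image β := fun n hn => Finset.mem_image_of_mem β hn
  rw [Finset.sum_product, ← Finset.sum_fiberwise_of_maps_to hmaps]
  refine Finset.sum_le_sum fun i _ => ?_
  have hin : ∀ n₁ ∈ S.filter (fun n => β n = i),
      ∑ n₂ ∈ S, c (n₁, n₂).1 * c (n₁, n₂).2 * K (n₁, n₂).1 (n₁, n₂).2 =
      ∑ j ∈ S.image β, ∑ n₂ ∈ S with β n₂ = j, c n₁ * c n₂ * K n₁ n₂ :=
    fun n₁ _ => (Finset.sum_fiberwise_of_maps_to hmaps _).symm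
  rw [Finset.sum_congr rfl hin, Finset.sum_comm]
  refine Finset.sum_le_sum fun j _ => ?_
  rw [Finset.sum_mul_sum, Finset.mul_sum]
  refine Finset.sum_le_sum fun n₁ hn₁ => ?_
  rw [Finset.mul_sum]
  refine Finset.sum_le_sum fun n₂ hn₂ => ?_
  obtain ⟨h₁S, h₁i⟩ := Finset.mem_filter.1 hn₁
  obtain ⟨h₂S, h₂j⟩ := Finset.mem_filter.1 hn₂
  rw [← h₁i, ← h₂j, mul_comm (ψ _ _)]
  exact mul_le_mul_of_nonneg_left (hK n₁ h₁S n₂ h₂S) (mul_nonneg (hc n₁ h₁S) (hc n₂ h₂S))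

/-- **Schur test** for a nonnegative matrix with row and column sums `≤ R`:
`∑_{i,j} ψ(i,j) A_i A_j ≤ R ∑_i A_i²` (from `A_i A_j ≤ (A_i² + A_j²)/2`). [folklore] -/
theorem schur_sum_mul_le {ι : Type*} (J : Finset ι) (ψ : ι → ι → ℝ) (A : ι → ℝ) (R : ℝ)
    (hψ : ∀ i ∈ J, ∀ j ∈ J, 0 ≤ ψ i j)
    (hrow : ∀ i ∈ J, ∑ j ∈ J, ψ i j ≤ R) (hcol : ∀ j ∈ J, ∑ i ∈ J, ψ i j ≤ R) :
    ∑ i ∈ J, ∑ j ∈ J, ψ i j * (A i * A j) ≤ R * ∑ i ∈ J, A i ^ 2 := by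
  have h1 : ∀ i ∈ J, ∀ j ∈ J,
      ψ i j * (A i * A j) ≤ (A i ^ 2 / 2) * ψ i j + (A j ^ 2 / 2) * ψ i j := by
    intro i hi j hj
    have := hψ i hi j hj
    nlinarith [sq_nonneg (A i - A j)]
  calc ∑ i ∈ J, ∑ j ∈ J, ψ i j * (A i * A j)
      ≤ ∑ i ∈ J, ∑ j ∈ J, ((A i ^ 2 / 2) * ψ i j + (A j ^ 2 / 2) * ψ i j) :=
        Finset.sum_le_sum fun i hi => Finset.sum_le_sum fun j hj => h1 i hi j hj
    _ = ∑ i ∈ J, (A i ^ 2 / 2) * ∑ j ∈ J, ψ i j + ∑ j ∈ J, (A j ^ 2 / 2) * ∑ i ∈ J, ψ i j := by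
        simp_rw [Finset.sum_add_distrib, Finset.mul_sum]
        congr 1
        exact Finset.sum_comm
    _ ≤ ∑ i ∈ J, (A i ^ 2 / 2) * R + ∑ j ∈ J, (A j ^ 2 / 2) * R := by
        gcongr with i hi j hj
        · exact hrow i hi
        · exact hcol j hj
    _ = R * ∑ i ∈ J, A i ^ 2 := by rw [← Finset.sum_mul, ← Finset.sum_div]; ring

/-! ### Step 6: box masses and close pairs -/

/-- If points of `S` in the same box are `Close`, then
`∑_boxes (∑_{n ∈ box} c_n)² ≤ ∑_n c_n² + ∑_{n₁ ≠ n₂, Close} c_{n₁} c_{n₂}` for `c ≥ 0`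
(expand the squares: a same-box pair is diagonal or a close off-diagonal pair). [folklore] -/
theorem sum_sq_boxSum_le {α : Type*} [DecidableEq α] (S : Finset α) (c : α → ℝ) (β : α → ℤ)
    (Close : α → α → Prop) [∀ n₁ n₂, Decidable (n₁ ≠ n₂ ∧ Close n₁ n₂)]
    (hc : ∀ n ∈ S, 0 ≤ c n) (hclose : ∀ n₁ ∈ S, ∀ n₂ ∈ S, β n₁ = β n₂ → Close n₁ n₂) :
    ∑ i ∈ S.image β, (∑ n ∈ S with β n = i, c n) ^ 2 ≤
      ∑ n ∈ S, c n ^ 2 + ∑ n₁ ∈ S, ∑ n₂ ∈ S, if n₁ ≠ n₂ ∧ Close n₁ n₂ then c n₁ * c n₂ else 0 := by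
  classical
  have hmaps : ∀ n ∈ S, β n ∈ S.image β := fun n hn => Finset.mem_image_of_mem β hn
  have hsq : ∀ i ∈ S.image β, (∑ n ∈ S with β n = i, c n) ^ 2 =
      ∑ n₁ ∈ S with β n₁ = i, ∑ n₂ ∈ S with β n₂ = β n₁, c n₁ * c n₂ := by
    intro i _
    rw [sq, Finset.sum_mul_sum]
    refine Finset.sum_congr rfl fun n₁ hn₁ => ?_
    rw [(Finset.mem_filter.1 hn₁).2]
  rw [Finset.sum_congr rfl hsq, Finset.sum_fiberwise_of_maps_to hmaps, ← Finset.sum_add_distrib]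
  refine Finset.sum_le_sum fun n₁ hn₁ => ?_
  have hdiag : c n₁ ^ 2 = ∑ n₂ ∈ S, if n₁ = n₂ then c n₁ * c n₂ else 0 := by
    rw [Finset.sum_ite_eq, if_pos hn₁, sq]
  rw [Finset.sum_filter, hdiag, ← Finset.sum_add_distrib]
  refine Finset.sum_le_sum fun n₂ hn₂ => ?_
  by_cases h : β n₂ = β n₁
  · rw [if_pos h]
    by_cases h' : n₁ = n₂
    · subst h'
      simp
    · rw [if_neg h', if_pos ⟨h', hclose n₁ hn₁ n₂ hn₂ h.symm⟩, zero_add]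
  · rw [if_neg h]
    have h' : n₁ ≠ n₂ := fun h'' => h (h'' ▸ rfl)
    rw [if_neg h']
    split_ifs
    · linarith [mul_nonneg (hc n₁ hn₁) (hc n₂ hn₂)]
    · simp

/-! ### The improved mean value theorem -/

open Classical in
/-- **Improved mean value theorem for Hecke polynomials of `ℤ[i]`** (Järviniemi–Teräväinen 2024,
Lemma 3.3), PROVED with the absolute constant `C = 129`: for `N ≥ 1`, `T ≥ 1` and all
coefficients `a`,
`∑_{|m| ≤ T} |∑_{N(n) ≤ N} a_n λ^m(n)|² ≤ 129 T ∑_{N(n) ≤ N} |a_n|²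
  + 129 T ∑_{N(n₁), N(n₂) ≤ N, n₁ ≠ n₂, |arg n₁ - arg n₂| ≤ 1/T (mod π/2)} |a_{n₁} a_{n₂}|`.
This discharges the named fact `JarviniemiTeravainen2024_heckeIMVT`. The proof (module
docstring) is the positivity/majorant argument of the source with all sums kept finite: Fejér
majorant in `m`, expansion, angular boxes of width `π/(4T)`, Schur test.
[cite: JarviniemiTeravainen2024, Lemma 3.3] -/
theorem JarviniemiTeravainen2024_heckeIMVT_holds : JarviniemiTeravainen2024_heckeIMVT := by
  refine ⟨129, fun N T a hN hT => ?_⟩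
  set S : Finset GaussianInt := normLEStar N with hSdef
  have hSq : ∀ n ∈ S, n ∈ firstQuadrant := fun n hn => (mem_normLEStar.1 hn).2
  set θ : GaussianInt → ℝ := fun n => 4 * arg (n : ℂ) with hθ
  set β : GaussianInt → ℤ := fun n => ⌊arg (n : ℂ) * (4 * T) / π⌋ with hβ
  set g : ℤ → ℝ := fun e =>
    if |e| ≤ 1 then (2 * (T : ℝ) + 1) ^ 2 else 4 * (T : ℝ) ^ 2 / (e : ℝ) ^ 2 with hg
  set ψ : ℤ → ℤ → ℝ := fun i j => g (i - j) + g (i - j + 2 * T) + g (i - j - 2 * T) with hψ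
  set K : GaussianInt → GaussianInt → ℝ := fun n₁ n₂ =>
    ‖∑ k ∈ range (2 * T + 1), exp (((θ n₁ - θ n₂ : ℝ) : ℂ) * I) ^ k‖ ^ 2 with hK
  set A : ℤ → ℝ := fun i => ∑ n ∈ S with β n = i, ‖a n‖ with hA
  set R : ℝ := 3 * (3 * (2 * (T : ℝ) + 1) ^ 2 + 16 * (T : ℝ) ^ 2) with hR
  have hT' : (1 : ℝ) ≤ T := by exact_mod_cast hT
  -- Step 1: counting, `(T+1) ∑_{|m| ≤ T} |F(m)|² ≤ ∑_{j,j' ≤ 2T} |F(j-j')|²`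
  have h1 : ((T : ℝ) + 1) * ∑ m ∈ Icc (-(T : ℤ)) T, ‖heckeSum N a m‖ ^ 2 ≤
      ∑ p ∈ range (2 * T + 1) ×ˢ range (2 * T + 1), ‖heckeSum N a ((p.1 : ℤ) - p.2)‖ ^ 2 :=
    mul_sum_Icc_le_sum_prod_range T (fun m => ‖heckeSum N a m‖ ^ 2) fun m => by positivity
  -- Step 2: expansion, Fejér kernel
  have hF : ∀ m : ℤ, heckeSum N a m = ∑ n ∈ S, a n * exp ((m : ℂ) * (θ n : ℂ) * I) := by
    intro m
    refine Finset.sum_congr rfl fun n hn => ?_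
    rw [angularCharZ_eq_exp (ne_zero_of_mem_firstQuadrant (hSq n hn))]
  have h2 : ∑ p ∈ range (2 * T + 1) ×ˢ range (2 * T + 1), ‖heckeSum N a ((p.1 : ℤ) - p.2)‖ ^ 2 ≤
      ∑ q ∈ S ×ˢ S, ‖a q.1‖ * ‖a q.2‖ * K q.1 q.2 :=
    sum_norm_sq_expSum_sub_le S a θ (2 * T + 1) (fun m => heckeSum N a m) hF
  -- Step 3: boxes
  have hKψ : ∀ n₁ ∈ S, ∀ n₂ ∈ S, K n₁ n₂ ≤ ψ (β n₁) (β n₂) := fun n₁ h₁ n₂ h₂ =>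
    norm_geom_sum_sq_le_boxKernel hT g (fun e => rfl) β (fun n => rfl) (hSq n₁ h₁) (hSq n₂ h₂)
  have h3 : ∑ q ∈ S ×ˢ S, ‖a q.1‖ * ‖a q.2‖ * K q.1 q.2 ≤
      ∑ i ∈ S.image β, ∑ j ∈ S.image β, ψ i j * (A i * A j) :=
    sum_mul_kernel_le_boxes S (fun n => ‖a n‖) K β ψ (fun n _ => norm_nonneg _) hKψ
  -- Step 4: Schur test on boxes
  have hg0 : ∀ e, 0 ≤ g e := fun e => by simp only [hg]; split_ifs <;> positivity
  have hgsum : ∀ (E : Finset ℤ) (h : ℤ → ℤ), Set.InjOn h E →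
      ∑ j ∈ E, g (h j) ≤ 3 * (2 * (T : ℝ) + 1) ^ 2 + 16 * (T : ℝ) ^ 2 := by
    intro E h hinj
    rw [← Finset.sum_image hinj]
    exact sum_boxWeight_le g (fun e => rfl) _
  have hrow : ∀ i ∈ S.image β, ∑ j ∈ S.image β, ψ i j ≤ R := by
    intro i _
    simp only [hψ, Finset.sum_add_distrib, hR]
    have ha := hgsum (S.image β) (fun j => i - j) (fun j _ j' _ h => by simpa using h)
    have hb := hgsum (S.image β) (fun j => i - j + 2 * T) (fun j _ j' _ h => by simpa using h)
    have hc := hgsum (S.image β) (fun j => i - j - 2 * T) (fun j _ j' _ h => by simpa using h)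
    linarith
  have hcol : ∀ j ∈ S.image β, ∑ i ∈ S.image β, ψ i j ≤ R := by
    intro j _
    simp only [hψ, Finset.sum_add_distrib, hR]
    have ha := hgsum (S.image β) (fun i => i - j) (fun i _ i' _ h => by simpa using h)
    have hb := hgsum (S.image β) (fun i => i - j + 2 * T) (fun i _ i' _ h => by simpa using h)
    have hc := hgsum (S.image β) (fun i => i - j - 2 * T) (fun i _ i' _ h => by simpa using h)
    linarith
  have h4 : ∑ i ∈ S.image β, ∑ j ∈ S.image β, ψ i j * (A i * A j) ≤
      R * ∑ i ∈ S.image β, A i ^ 2 :=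
    schur_sum_mul_le (S.image β) ψ A R
      (fun i _ j _ => add_nonneg (add_nonneg (hg0 _) (hg0 _)) (hg0 _)) hrow hcol
  -- Step 5: boxes to close pairs
  have hclose : ∀ n₁ ∈ S, ∀ n₂ ∈ S, β n₁ = β n₂ → ArgClose T n₁ n₂ := fun n₁ h₁ n₂ h₂ h =>
    argClose_of_floor_eq hT (hSq n₁ h₁) (hSq n₂ h₂) h
  have h5 : ∑ i ∈ S.image β, A i ^ 2 ≤
      ∑ n ∈ S, ‖a n‖ ^ 2 + ∑ n₁ ∈ S, ∑ n₂ ∈ S,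
        if n₁ ≠ n₂ ∧ ArgClose T n₁ n₂ then ‖a n₁‖ * ‖a n₂‖ else 0 :=
    sum_sq_boxSum_le S (fun n => ‖a n‖) β (ArgClose T) (fun n _ => norm_nonneg _) hclose
  -- combine
  have hW : (∑ n₁ ∈ S, ∑ n₂ ∈ S, if n₁ ≠ n₂ ∧ ArgClose T n₁ n₂ then ‖a n₁‖ * ‖a n₂‖ else 0) =
      ∑ n₁ ∈ S, ∑ n₂ ∈ S, if n₁ ≠ n₂ ∧ ArgClose T n₁ n₂ then ‖a n₁ * a n₂‖ else 0 := by
    simp_rw [norm_mul]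
  set X := ∑ m ∈ Icc (-(T : ℤ)) T, ‖heckeSum N a m‖ ^ 2 with hX
  set W₁ := ∑ n ∈ S, ‖a n‖ ^ 2 with hW₁
  set W₂ := ∑ n₁ ∈ S, ∑ n₂ ∈ S, (if n₁ ≠ n₂ ∧ ArgClose T n₁ n₂ then ‖a n₁ * a n₂‖ else 0)
    with hW₂
  have hW₁0 : 0 ≤ W₁ := Finset.sum_nonneg fun _ _ => by positivity
  have hW₂0 : 0 ≤ W₂ :=
    Finset.sum_nonneg fun _ _ => Finset.sum_nonneg fun _ _ => by split_ifs <;> positivity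
  have hR0 : 0 ≤ R := by positivity
  have hRle : R ≤ 129 * (T : ℝ) ^ 2 := by rw [hR]; nlinarith
  have hmain : ((T : ℝ) + 1) * X ≤ R * (W₁ + W₂) :=
    calc ((T : ℝ) + 1) * X ≤ _ := h1
      _ ≤ _ := h2
      _ ≤ _ := h3
      _ ≤ _ := h4
      _ ≤ R * (W₁ + W₂) := by rw [← hW]; exact mul_le_mul_of_nonneg_left h5 hR0
  have key : ((T : ℝ) + 1) * X ≤ ((T : ℝ) + 1) * (129 * T * W₁ + 129 * T * W₂) := by
    have hTT : R * (W₁ + W₂) ≤ 129 * (T : ℝ) ^ 2 * (W₁ + W₂) :=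
      mul_le_mul_of_nonneg_right hRle (add_nonneg hW₁0 hW₂0)
    nlinarith [mul_nonneg (by positivity : (0 : ℝ) ≤ T) (add_nonneg hW₁0 hW₂0)]
  exact le_of_mul_le_mul_left key (by positivity)

end Literature.NumberTheory.LFunctions.GaussianInt

end
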